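import Summits.BirchSwinnertonDyer.BirchSwinnertonDyer.Theorems.CyclotomicUntwistWildThreeShapeLawDicyclicTable
import Summits.BirchSwinnertonDyer.BirchSwinnertonDyer.Theorems.CyclotomicUntwistPSWildThreeShapeLawRowFour
import Summits.BirchSwinnertonDyer.Rank1Residual.Additive.WildThreeResidualShapeLocIrr
import Literature.NumberTheory.EllipticCurves.RootNumberTableThreeCondExpProofs
import HarnessLib

/-!
# The O6 SHAPE LAW `WildThreeResidualShapeByKodaira` IS A THEOREM: the dicyclic rows `v₃N ∈ {3, 5}`
# (Rizzo's Table II + the E89 irreducibility criterion) and the assembly with the `v₃N = 4` row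

Cell `pub/bsd-wall` (D-0145 line `route-BirchSwinnertonDyer-CyclotomicUntwist`), seat `bsd-line-cycu-p2`
(prover seat 2/3, gen 3), helper toward K1 `PSRankOneLowerHalfAtThree` (stmt-BirchSwinnertonDyer-21580) and
K2 `PSRankOneUpperHalfAtThree` (stmt-21581); serves the O6 lane (o6-r1 V10, cell `b2b-bsdres`). THEOREMS
ONLY (no definition, no named fact, no `sorry`); BSD is not proved by this file and no crux is. What IS
proved: the conjecture-tagged node `Summit.BirchSwinnertonDyer.Rank1Residual.Additive.WildThreeResidualShapeByKodaira`
(`Additive/WildThreeResidualShapeLaws.lean`; census EVIDENCE 154 058/154 058) holds —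
`wildThreeResidualShapeByKodaira_holds` — so its consumers may instantiate their `(h : WildThreeResidualShapeByKodaira)`
binders by name. The node itself is not edited here (attribute removal is the O6 typer's call).

## Proof
* `v₃N = 4` (cyclic cell, `v₃Δ_min` even): this seat's `wildThreeResidualShapeByKodaira_row_four`
  (Kraus middle entry `v₃c₆ ∈ {3,5,6,8}` + x11b3's parity dictionary).
* `v₃N ∈ {3, 5}` (dicyclic cell, `v₃Δ_min` odd): Table II's `v(N)` column IS the conductor exponent
  (DISCHARGED named fact `WeierstrassCurve.conductorExponent_eq_tableConductorExponentThree_holds`), so the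
  table layer (`rows_of_condExpOfInvariants_eq_three/five`) pins `v₃(c₆)` on each Papadopoulos window:
  `v(N) = 3`: II `(·,3,3)` odd / `(2,4,3)` even, IV `(2,3,5)` odd, IV* `(·,6,9)` even / `(4,7,9)` odd, II* `(4,6,11)`
  even; `v(N) = 5`: II `(·,4,5)` even, IV `(·,5,7)` odd, IV* `(·,7,11)` odd, II* `(·,8,13)` even. The parity is
  the one the law wants (`shapeOrdSideThree_iff_even` / `shapeEtSideThree_iff_odd`: ORD ⟺ `v₃c₆` even on the
  one-stable-line locus) EXCEPT on the two special rows `(2,4,3)`, `(4,7,9)` — and there `3v₃c₄ + 2 ≤ 2v₃c₆`,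
  so `W[3]|G_ℚ₃` is IRREDUCIBLE (harvest-2 E89 `locIrr_three_of_le'` + `locIrr_three_iff_shapeIrrThree`): no
  stable line, both shape hypotheses are vacuous (`parity_or_locIrr_of_odd`).
References: O. Rizzo, Compositio Math. 136 (2003), Table II [Rizzo2003]; A. Kraus, Manuscripta Math. 69
(1990), Théorème (p = 3) [Kraus1990]; J.-P. Serre, Invent. Math. 15 (1972), §1.11 [Serre1972].
-/

set_option autoImplicit false
-- single-conjunct summit: `Summit.BirchSwinnertonDyer.BirchSwinnertonDyer.…` repeats the name by design
set_option linter.dupNamespace false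

noncomputable section

open scoped Classical

open WeierstrassCurve IsDedekindDomain Rat.HeightOneSpectrum Literature.NumberTheory.EllipticCurves
  Literature.NumberTheory.EllipticCurves.Rank1Residual Literature.NumberTheory.DiophantineGeometry
  Summit.BirchSwinnertonDyer.Rank1Residual.Additive Summit.BirchSwinnertonDyer.Rank1Residual.O5

namespace Summit.BirchSwinnertonDyer.BirchSwinnertonDyer.Theorems.PSLocalThreeTorsion

section Dicyclic

variable (W : WeierstrassCurve ℚ) [W.IsElliptic] [W.IsGloballyMinimal]

omit [W.IsGloballyMinimal] in
/-- Table II's `v(N)` column is the conductor exponent at `3` (the discharged named fact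
`WeierstrassCurve.conductorExponent_eq_tableConductorExponentThree`, `…_holds`).
[cite: Rizzo2003, Table II (p. 4), column v(N)] -/
theorem condExpOfInvariants_eq_condExp : Rizzo.condExpOfInvariants W.c₄ W.c₆ W.Δ = condExp W 3 := by
  have h := WeierstrassCurve.conductorExponent_eq_tableConductorExponentThree_holds W (placeOf 3)
    (ringChar_int_quot_placeOf 3)
  rw [tableConductorExponentThree_def] at h
  exact h.symm

/-- **The dicyclic rows: the parity of `v₃(c₆)` is the one tabulated by `ordSideKodairaThree`, unless
`W[3]|G_ℚ₃` is irreducible.** On the wild cell with `v₃Δ_min` odd (`condExp W 3 ∈ {3, 5}`): either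
`LocIrr W 3` (the special rows `(2,4,3)`, `(4,7,9)` of Table II, where `3v₃c₄ + 2 ≤ 2v₃c₆`), or
`ordSideKodairaThree (condExp W 3) (K₃ W) = true ⟺ v₃(c₆)` is even.
[cite: Rizzo2003, Table II (p. 4)] [cite: Kraus1990, Théorème (p = 3)] -/
theorem parity_or_locIrr_of_odd (hO6 : ClassO6 W 3) (hodd : Odd (padicValInt 3 W.minimalDiscriminantInt)) :
    LocIrr W 3 ∨
      (ordSideKodairaThree (condExp W 3) (W.kodairaSymbolAt (placeOf 3)) = true ↔
        Even (padicValRat 3 W.c₆)) := by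
  obtain ⟨-, hadd, hW⟩ := hO6
  have hvQ : padicValRat 3 W.Δ = padicValInt 3 W.minimalDiscriminantInt :=
    padicValRat_Δ_eq_padicValInt_minimalDiscriminantInt W
  have htab := condExpOfInvariants_eq_condExp W
  have hwin := PSKodairaDictionary.kodairaSymbolAt_windows W hadd hW
  rcases (PSKodairaDictionary.condExp_eq_three_or_five_iff_odd W hadd hW).mpr hodd with hf | hf
  · -- `v(N) = 3`
    rw [hf] at htab hwin
    have hv : padicValRat 3 W.Δ = 3 ∨ padicValRat 3 W.Δ = 5 ∨ padicValRat 3 W.Δ = 9 ∨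
        padicValRat 3 W.Δ = 11 := by
      rw [hvQ]
      rcases hwin with ⟨-, h1, h2, h3⟩ | ⟨-, h1, h2, h3⟩ | ⟨-, h1, h2, h3⟩ | ⟨-, h1, h2, h3⟩ <;> omega
    obtain ⟨hc6, hrows⟩ := rows_of_condExpOfInvariants_eq_three htab hv
    rw [hvQ] at hrows
    rcases hrows with ⟨hb, hc⟩ | ⟨hc4, ha, hb, hc⟩ | ⟨hb, hc⟩ | ⟨hb, hc⟩ | ⟨hc4, ha, hb, hc⟩ | ⟨hb, hc⟩
    · right
      rcases hwin with ⟨hK, h1, h2, h3⟩ | ⟨hK, h1, h2, h3⟩ | ⟨hK, h1, h2, h3⟩ | ⟨hK, h1, h2, h3⟩ <;>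
        first | (exfalso; omega) | (rw [hK, hf, hb]; decide)
    · exact Or.inl (locIrr_three_of_le' W hc4 (by rw [ha, hb]; norm_num))
    · right
      rcases hwin with ⟨hK, h1, h2, h3⟩ | ⟨hK, h1, h2, h3⟩ | ⟨hK, h1, h2, h3⟩ | ⟨hK, h1, h2, h3⟩ <;>
        first | (exfalso; omega) | (rw [hK, hf, hb]; decide)
    · right
      rcases hwin with ⟨hK, h1, h2, h3⟩ | ⟨hK, h1, h2, h3⟩ | ⟨hK, h1, h2, h3⟩ | ⟨hK, h1, h2, h3⟩ <;>
        first | (exfalso; omega) | (rw [hK, hf, hb]; decide)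
    · exact Or.inl (locIrr_three_of_le' W hc4 (by rw [ha, hb]; norm_num))
    · right
      rcases hwin with ⟨hK, h1, h2, h3⟩ | ⟨hK, h1, h2, h3⟩ | ⟨hK, h1, h2, h3⟩ | ⟨hK, h1, h2, h3⟩ <;>
        first | (exfalso; omega) | (rw [hK, hf, hb]; decide)
  · -- `v(N) = 5`
    rw [hf] at htab hwin
    have hv : padicValRat 3 W.Δ = 5 ∨ padicValRat 3 W.Δ = 7 ∨ padicValRat 3 W.Δ = 11 ∨
        padicValRat 3 W.Δ = 13 := by
      rw [hvQ]
      rcases hwin with ⟨-, h1, h2, h3⟩ | ⟨-, h1, h2, h3⟩ | ⟨-, h1, h2, h3⟩ | ⟨-, h1, h2, h3⟩ <;> omega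
    obtain ⟨hc6, hrows⟩ := rows_of_condExpOfInvariants_eq_five htab hv
    rw [hvQ] at hrows
    right
    rcases hrows with ⟨hb, hc⟩ | ⟨hb, hc⟩ | ⟨hb, hc⟩ | ⟨hb, hc⟩ <;>
      rcases hwin with ⟨hK, h1, h2, h3⟩ | ⟨hK, h1, h2, h3⟩ | ⟨hK, h1, h2, h3⟩ | ⟨hK, h1, h2, h3⟩ <;>
        first | (exfalso; omega) | (rw [hK, hf, hb]; decide)

omit W [W.IsElliptic] [W.IsGloballyMinimal] in
/-- **The `v₃N ∈ {3, 5}` rows of the SHAPE LAW** (dicyclic cell, `v₃Δ_min` odd): ORD-side ⟹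
`ordSideKodairaThree (condExp W 3) (K₃ W) = true`, ET-side ⟹ `= false`. On a locally irreducible `W` both
hypotheses are vacuous (no stable line); otherwise the parity of `v₃(c₆)` decides (x11b3's
`shapeOrdSideThree_iff_even` / `shapeEtSideThree_iff_odd`). [cite: Rizzo2003, Table II (p. 4)] [cite: Serre1972, §1.11] -/
theorem wildThreeResidualShapeByKodaira_dicyclic :
    ∀ (W : WeierstrassCurve ℚ) [W.IsElliptic] [W.IsGloballyMinimal], ClassO6 W 3 →
      Odd (padicValInt 3 W.minimalDiscriminantInt) →
      (ShapeOrdSideThree W → ordSideKodairaThree (condExp W 3) (W.kodairaSymbolAt (placeOf 3)) = true) ∧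
      (ShapeEtSideThree W → ordSideKodairaThree (condExp W 3) (W.kodairaSymbolAt (placeOf 3)) = false) := by
  intro W _ _ hO6 hodd
  rcases parity_or_locIrr_of_odd W hO6 hodd with hirr | hpar
  · -- locally irreducible: no stable line at all
    have hno : ShapeIrrThree W := (locIrr_three_iff_shapeIrrThree W).mp hirr
    constructor
    · intro hOrd
      exfalso
      rcases hOrd with ⟨x₀, hx, -⟩ | ⟨x₀, hx, -⟩ <;> exact hno x₀ hx.1
    · intro hEt
      exfalso
      rcases hEt with ⟨x₀, hx, -⟩ | ⟨x₀, hx, -⟩ <;> exact hno x₀ hx.1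
  · constructor
    · intro hOrd
      have h1 : ∃ x₀, IsUniqueStableLineThree W x₀ := by
        rcases hOrd with ⟨x₀, hx, -⟩ | ⟨x₀, hx, -⟩ <;> exact ⟨x₀, hx⟩
      exact hpar.mpr ((shapeOrdSideThree_iff_even W h1).mp hOrd)
    · intro hEt
      have h1 : ∃ x₀, IsUniqueStableLineThree W x₀ := by
        rcases hEt with ⟨x₀, hx, -⟩ | ⟨x₀, hx, -⟩ <;> exact ⟨x₀, hx⟩
      have hodd' := (shapeEtSideThree_iff_odd W h1).mp hEt
      cases hb : ordSideKodairaThree (condExp W 3) (W.kodairaSymbolAt (placeOf 3))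
      · rfl
      · exact absurd (hpar.mp hb) (Int.not_even_iff_odd.mpr hodd')

omit W [W.IsElliptic] [W.IsGloballyMinimal] in
/-- **THE O6 SHAPE LAW HOLDS** (o6-r1 GEN 10 V10; was conjecture-tagged, census 154 058/154 058): for every
elliptic, globally minimal `W/ℚ` on the wild cell at `3` (`ClassO6 W 3`), the ORD-side / ET-side of the local
residual shape `W[3]|G_ℚ₃` is the one tabulated by `(condExp W 3, K₃ W)` — rows `v₃N = 4` (this seat's
`wildThreeResidualShapeByKodaira_row_four`) and `v₃N ∈ {3, 5}` (`…_dicyclic`).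
[cite: Kraus1990, Théorème (p = 3)] [cite: Rizzo2003, Table II (p. 4)] [cite: Serre1972, §1.11] -/
theorem wildThreeResidualShapeByKodaira_holds : WildThreeResidualShapeByKodaira := by
  intro W _ _ hO6
  rcases Nat.even_or_odd (padicValInt 3 W.minimalDiscriminantInt) with hev | hodd
  · exact wildThreeResidualShapeByKodaira_row_four W hO6 hev
  · exact wildThreeResidualShapeByKodaira_dicyclic W hO6 hodd

omit W [W.IsElliptic] [W.IsGloballyMinimal] in
/-- The law in x11b3's `c₆`-parity currency, now unconditional: on the one-stable-line locus of the wild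
cell, `ordSideKodairaThree (condExp W 3) (K₃ W) = true ⟺ v₃(c₆)` even. [cite: Serre1972, §1.11] -/
theorem ordSideKodairaThree_iff_even_c₆ :
    ∀ (W : WeierstrassCurve ℚ) [W.IsElliptic] [W.IsGloballyMinimal], ClassO6 W 3 →
      (∃ x₀, IsUniqueStableLineThree W x₀) →
        (ordSideKodairaThree (condExp W 3) (W.kodairaSymbolAt (placeOf 3)) = true ↔
          Even (padicValRat 3 W.c₆)) :=
  wildThreeResidualShapeByKodaira_iff_even_c₆.mp wildThreeResidualShapeByKodaira_holds

end Dicyclic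

end Summit.BirchSwinnertonDyer.BirchSwinnertonDyer.Theorems.PSLocalThreeTorsion

end
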